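import Summits.BirchSwinnertonDyer.BirchSwinnertonDyer.Theorems.GoldfeldGoodTwistsPublishedInputs
import Literature.NumberTheory.EllipticCurves.BSDSelmerSmithTwistClassDensityProofs
import Literature.NumberTheory.EllipticCurves.Kriz2020.GoldfeldJ1728Proofs
import HarnessLib

/-!
# Goldfeld for `X₀(49)` over ALL squarefree twists: two thirds unconditionally, the rest modulo one `2`-converse

Cell `bsd-goldfeld` (planner seat, generation 4), file 10 — the ALL-TWISTS axis. Theorems only:
no named fact, no axiom, no definition. `E₀ = X₀(49) = 49a1 = cm7 = [1, −1, 0, −2, −1]`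
(`j = −3375`, CM by `ℤ[(1+√−7)/2]`); densities are the tree's `twistDensity` (natural density among
ALL squarefree `d`, both signs, ordered by `|d|`) unless a relative density inside the good family
`𝓕 = {d squarefree : d ≡ 1 (mod 4)}` (twists with good ordinary reduction at `2`) is displayed.

1. **Absolute densities of the cell's three clauses** (§1). Files 3–5 prove RELATIVE densities
   inside `𝓕` (`100 %`, `50 %`, `50 %`); `𝓕` itself has density exactly `1/3`
   (`twistDensity_emod_four_eq_one`, Literature file `BSDSelmerSmithTwistClassDensityProofs`), so
   (`twistDensity_third_of_tendsto_familyProportion_one`, `…_sixth_of_…_half`): the squarefree `d`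
   with `d ≡ 1 (mod 4)` and rank BSD + finite `Ш` for `E₀^{(d)}` have density `1/3`; those with
   `d ≡ 1 (mod 4)` and `ord_{s=1} L = rank = 0`, resp. `= 1`, and finite `Ш` have density `1/6` each.

2. **Rank BSD for at least two thirds of ALL quadratic twists of `X₀(49)`** (§2,
   `bsdRank_twoThirds_allTwists_of_X049`). The set `Q₀ = {d : ord_{s=1} L(E₀^{(d)}, s) = 0,
   rank E₀^{(d)}(ℚ) = 0, Ш finite}` has density EXACTLY `1/2` among all squarefree `d` (file 7,
   `twistDensity_rankZero_bsd_of_hasCM`: Smith + Burungale–Tian + GZK, no condition at `2`), and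
   `Q₁ = {d ≡ 1 (mod 4) : ord_{s=1} L = rank = 1, Ш finite}` has density `1/6` (item 1); they are
   disjoint, so `Q₀ ∪ Q₁` has density `2/3` (`twistDensity.add`) and the set of squarefree `d` with
   `ord_{s=1} L(E₀^{(d)}, s) = rank E₀^{(d)}(ℚ)` and `Ш(E₀^{(d)}/ℚ)` finite has LOWER density
   `≥ 2/3`: for every `ε > 0`, eventually `#{|d| ≤ X : …} / #{|d| ≤ X squarefree} ≥ 2/3 − ε`
   (`twistDensity.eventually_le_ratio`). Hypotheses `{hS (or h22), hBT, hA, hGZK, hmod}` as in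
   files 3–7. The complement of `Q₀ ∪ Q₁` has density exactly `1/3`
   (`twistDensity_not_rankZero_or_rankOneInClass_X049`): up to a density-`0` set it is
   `{d ≢ 1 (mod 4) : corank_{ℤ_2} Sel_{2^∞}(E₀^{(d)}) = 1}` — the twists with ADDITIVE (potentially
   good ordinary) reduction at `2` and `2^∞`-Selmer corank `1`, for which no rank-one `2`-converse
   is in print.

3. **The residual, as an explicit hypothesis** (§3). The missing input is ONE statement, the
   rank-one `2`-converse for the `ℚ(√−7)`-CM curves WITHOUT a good-reduction clause at `2`
   ("K12₂′" in the cell's bus; handed to cell `bsd-cm` by the director, D-0059):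
   `∀ W/ℚ elliptic, j(W) ∈ {−3375, 16581375} → corank_{ℤ_2} Sel_{2^∞}(W/ℚ) = 1 → ord_{s=1} L(W, s) = 1`.
   It is NOT in print and is carried here as an INLINE HYPOTHESIS `hK` (no definition is made):
   Burungale–Castella–Skinner–Tian, Thm. A needs good ordinary reduction at `p` and their Remark D
   names the potentially-good-ordinary case as a desideratum; Keller–Yin (arXiv:2410.23241,
   Thm. 0.1.2) prove exactly this shape for `p > 2`; Kriz (arXiv:2002.04767) treats `p` ramified
   in the CM field. Given `hK` (which subsumes `hA` = BCST Thm. A for these curves, so `hA` is not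
   a hypothesis of these theorems): Goldfeld's conjecture for `X₀(49)` in printed form over ALL `d`
   (`1/2, 1/2, 0`; also in the `#{0 < |d| ≤ H}/2H` normalisation) and rank BSD + finite `Ш` for
   `100 %` of ALL squarefree twists (`bsdRank_allTwists_of_X049_of_twoConverse`). The sharper
   `bsdRank_allTwists_of_X049_of_offClass_twoConverse` assumes the converse ONLY for the twists
   `E₀^{(d)}`, `d` squarefree, `d ≢ 1 (mod 4)` (and uses `hA` on `𝓕`): this is the precise sense
   in which K12₂′ is the residual of the cell's target over all twists.

References: A. Smith, J. Amer. Math. Soc. 39 (2026), Thm. 1.2 [Smith2022SelmerTwistI]; A. Smith,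
arXiv:2503.17619, Thm. 1.1, Cor. 1.2–1.3 [arXiv250317619]; A. Burungale, Y. Tian, Ann. of Math. 203
(2026), Thm. 1.1 [BurungaleTian2026]; A. Burungale, F. Castella, C. Skinner, Y. Tian, Ann. Math. Qué.
46 (2022), Thm. A and Rem. D [BurungaleCastellaSkinnerTian2022]; T. Keller, M. Yin, arXiv:2410.23241,
Thm. 0.1.2 [KellerYin2024PotOrd]; D. Kriz, arXiv:2002.04767 [Kriz2020]; W. Orr, J. London Math.
Soc. (2) 3 (1971) [Orr1971] (density of squarefree integers in residue classes mod `4`).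
-/

set_option linter.dupNamespace false
set_option autoImplicit false

noncomputable section

open scoped Classical

open Filter Topology WeierstrassCurve Literature.NumberTheory.EllipticCurves
  Literature.NumberTheory.EllipticCurves.BurungaleCastellaSkinnerTian2022
  Literature.NumberTheory.EllipticCurves.ModularForms

namespace Summit.BirchSwinnertonDyer.BirchSwinnertonDyer.Theorems.GoldfeldGoodTwists

/-! ## §1 Absolute densities of the good family's clauses -/

/-- **Rank BSD on the good family, absolute form.** The squarefree `d ≡ 1 (mod 4)` with
`ord_{s=1} L(E₀^{(d)}, s) = rank E₀^{(d)}(ℚ)` and `Ш(E₀^{(d)}/ℚ)` finite have density `1/3` among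
ALL squarefree `d` (`= density(𝓕) · 100 %`). [cite: arXiv250317619, Thm. 1.1 and Cor. 1.3]
[cite: BurungaleTian2026, Thm. 1.1] [cite: BurungaleCastellaSkinnerTian2022, Thm. A]
[cite: Orr1971, §II (squarefree integers in residue classes mod 4)] -/
theorem twistDensity_bsdRank_inClass_X049
    (hS : smith_selmerCorank_density cm7)
    (hBT : burungaleTian_analyticRank_eq_zero_of_selmerCorank_eq_zero_of_hasCM)
    (hA : thmA_analyticRank_eq_one_of_selmerCorank_eq_one)
    (hGZK : rank_eq_analyticRank_of_analyticRank_le_one) :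
    twistDensity (fun d ↦ d % 4 = 1 ∧
      ((cm7.quadraticTwist d).analyticRank = (cm7.quadraticTwist d).mordellWeilRank ∧
        Finite (cm7.quadraticTwist d).sha)) (1 / 3) :=
  twistDensity_third_of_tendsto_familyProportion_one (bsdRank_densityOne_twists_of_X049 hS hBT hA hGZK)

/-- **The even half of the good family, absolute form**: the squarefree `d ≡ 1 (mod 4)` with
`ord_{s=1} L(E₀^{(d)}, s) = rank E₀^{(d)}(ℚ) = 0` and `Ш(E₀^{(d)}/ℚ)` finite have density `1/6`
among all squarefree `d` (`= 1/3 · 1/2`). [cite: arXiv250317619, Thm. 1.1 and Cor. 1.2–1.3]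
[cite: BurungaleTian2026, Thm. 1.1] [cite: Orr1971, §II] -/
theorem twistDensity_rankZero_inClass_X049
    (hS : smith_selmerCorank_density cm7)
    (hBT : burungaleTian_analyticRank_eq_zero_of_selmerCorank_eq_zero_of_hasCM)
    (hA : thmA_analyticRank_eq_one_of_selmerCorank_eq_one)
    (hGZK : rank_eq_analyticRank_of_analyticRank_le_one) (hmod : exists_isNewformOf) :
    twistDensity (fun d ↦ d % 4 = 1 ∧
      ((cm7.quadraticTwist d).analyticRank = 0 ∧ (cm7.quadraticTwist d).mordellWeilRank = 0 ∧
        Finite (cm7.quadraticTwist d).sha)) (1 / 6) :=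
  twistDensity_sixth_of_tendsto_familyProportion_half
    (goldfeld_rankZero_half_twists_of_X049 hS hBT hA hGZK hmod)

/-- **The odd half of the good family, absolute form**: the squarefree `d ≡ 1 (mod 4)` with
`ord_{s=1} L(E₀^{(d)}, s) = rank E₀^{(d)}(ℚ) = 1` and `Ш(E₀^{(d)}/ℚ)` finite have density `1/6`
among all squarefree `d`. [cite: arXiv250317619, Thm. 1.1 and Cor. 1.2–1.3]
[cite: BurungaleCastellaSkinnerTian2022, Thm. A] [cite: Orr1971, §II] -/
theorem twistDensity_rankOne_inClass_X049
    (hS : smith_selmerCorank_density cm7)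
    (hBT : burungaleTian_analyticRank_eq_zero_of_selmerCorank_eq_zero_of_hasCM)
    (hA : thmA_analyticRank_eq_one_of_selmerCorank_eq_one)
    (hGZK : rank_eq_analyticRank_of_analyticRank_le_one) (hmod : exists_isNewformOf) :
    twistDensity (fun d ↦ d % 4 = 1 ∧
      ((cm7.quadraticTwist d).analyticRank = 1 ∧ (cm7.quadraticTwist d).mordellWeilRank = 1 ∧
        Finite (cm7.quadraticTwist d).sha)) (1 / 6) :=
  twistDensity_sixth_of_tendsto_familyProportion_half
    (goldfeld_rankOne_half_twists_of_X049 hS hBT hA hGZK hmod)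

/-! ## §2 Rank BSD for at least two thirds of all squarefree twists -/

/-- **`Q₀ ∪ Q₁` has density exactly `2/3`.** Among all squarefree `d`: (`ord_{s=1} L(E₀^{(d)}, s) =
rank E₀^{(d)}(ℚ) = 0` and `Ш` finite) OR (`d ≡ 1 (mod 4)` and `ord_{s=1} L = rank = 1` and `Ш`
finite) holds with density `1/2 + 1/6 = 2/3` — the two pieces are disjoint (`twistDensity.add`);
the first has density `1/2` with NO condition at `2` (`twistDensity_rankZero_bsd_of_hasCM`).
[cite: arXiv250317619, Thm. 1.1 and Cor. 1.2–1.3] [cite: BurungaleTian2026, Thm. 1.1]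
[cite: BurungaleCastellaSkinnerTian2022, Thm. A] -/
theorem twistDensity_rankZero_or_rankOneInClass_X049
    (hS : smith_selmerCorank_density cm7)
    (hBT : burungaleTian_analyticRank_eq_zero_of_selmerCorank_eq_zero_of_hasCM)
    (hA : thmA_analyticRank_eq_one_of_selmerCorank_eq_one)
    (hGZK : rank_eq_analyticRank_of_analyticRank_le_one) (hmod : exists_isNewformOf) :
    twistDensity (fun d ↦
      ((cm7.quadraticTwist d).analyticRank = 0 ∧ (cm7.quadraticTwist d).mordellWeilRank = 0 ∧
          Finite (cm7.quadraticTwist d).sha) ∨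
        (d % 4 = 1 ∧ ((cm7.quadraticTwist d).analyticRank = 1 ∧
          (cm7.quadraticTwist d).mordellWeilRank = 1 ∧ Finite (cm7.quadraticTwist d).sha))) (2 / 3) := by
  rw [show (2 / 3 : ℝ) = 1 / 2 + 1 / 6 by norm_num]
  exact (twistDensity_rankZero_bsd_of_hasCM hBT hGZK cm7 (hasCM_of_j_eq_neg3375 cm7 j_cm7) hS).add
    (twistDensity_rankOne_inClass_X049 hS hBT hA hGZK hmod)
    (fun _ _ h0 h1 ↦ absurd (h0.1.symm.trans h1.2.1) (by norm_num))

/-- **The missing third.** The complement — squarefree `d` for which NEITHER (`ord L = rank = 0`,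
`Ш` finite) NOR (`d ≡ 1 (mod 4)`, `ord L = rank = 1`, `Ш` finite) — has density exactly `1/3`; by
Smith's theorem it is, up to density `0`, the set `{d ≢ 1 (mod 4) : corank_{ℤ_2} Sel_{2^∞}(E₀^{(d)})
= 1}` of corank-one twists with additive reduction at `2` (§3). [cite: arXiv250317619, Thm. 1.1] -/
theorem twistDensity_not_rankZero_or_rankOneInClass_X049
    (hS : smith_selmerCorank_density cm7)
    (hBT : burungaleTian_analyticRank_eq_zero_of_selmerCorank_eq_zero_of_hasCM)
    (hA : thmA_analyticRank_eq_one_of_selmerCorank_eq_one)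
    (hGZK : rank_eq_analyticRank_of_analyticRank_le_one) (hmod : exists_isNewformOf) :
    twistDensity (fun d ↦ ¬
      (((cm7.quadraticTwist d).analyticRank = 0 ∧ (cm7.quadraticTwist d).mordellWeilRank = 0 ∧
          Finite (cm7.quadraticTwist d).sha) ∨
        (d % 4 = 1 ∧ ((cm7.quadraticTwist d).analyticRank = 1 ∧
          (cm7.quadraticTwist d).mordellWeilRank = 1 ∧ Finite (cm7.quadraticTwist d).sha)))) (1 / 3) := by
  have h := (twistDensity_rankZero_or_rankOneInClass_X049 hS hBT hA hGZK hmod).compl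
  rwa [show (1 : ℝ) - 2 / 3 = 1 / 3 by norm_num] at h

/-- **Rank BSD for at least two thirds of ALL quadratic twists of `X₀(49)`.** For `E₀ = 49a1`,
assuming Smith's distribution theorem for `E₀` (`hS`), Burungale–Tian (`hBT`), BCST Thm. A (`hA`,
at `p = 2`), Gross–Zagier–Kolyvagin (`hGZK`) and Modularity (`hmod`): for every `ε > 0`, for all
large `X`, at least a proportion `2/3 − ε` of the squarefree `|d| ≤ X` satisfy
`ord_{s=1} L(E₀^{(d)}, s) = rank E₀^{(d)}(ℚ)` with `Ш(E₀^{(d)}/ℚ)` finite (lower natural density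
`≥ 2/3`; the set need not have a density). The `2/3 = 1/2 + 1/6` is `Q₀ ∪ Q₁` of
`twistDensity_rankZero_or_rankOneInClass_X049`. [cite: arXiv250317619, Thm. 1.1 and Cor. 1.2–1.3]
[cite: BurungaleTian2026, Thm. 1.1] [cite: BurungaleCastellaSkinnerTian2022, Thm. A] [cite: Orr1971, §II] -/
theorem bsdRank_twoThirds_allTwists_of_X049
    (hS : smith_selmerCorank_density cm7)
    (hBT : burungaleTian_analyticRank_eq_zero_of_selmerCorank_eq_zero_of_hasCM)
    (hA : thmA_analyticRank_eq_one_of_selmerCorank_eq_one)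
    (hGZK : rank_eq_analyticRank_of_analyticRank_le_one) (hmod : exists_isNewformOf)
    {ε : ℝ} (hε : 0 < ε) :
    ∀ᶠ X : ℕ in atTop, 2 / 3 - ε ≤ (Nat.card {d : ℤ | Squarefree d ∧ |d| ≤ (X : ℤ) ∧
        ((cm7.quadraticTwist d).analyticRank = (cm7.quadraticTwist d).mordellWeilRank ∧
          Finite (cm7.quadraticTwist d).sha)} : ℝ) /
      Nat.card {d : ℤ | Squarefree d ∧ |d| ≤ (X : ℤ)} :=
  (twistDensity_rankZero_or_rankOneInClass_X049 hS hBT hA hGZK hmod).eventually_le_ratio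
    (fun _ _ h ↦ h.elim (fun h0 ↦ ⟨h0.1.trans h0.2.1.symm, h0.2.2⟩)
      (fun h1 ↦ ⟨h1.2.1.trans h1.2.2.1.symm, h1.2.2.2⟩)) hε

/-- **Rank BSD for at least two thirds of all quadratic twists of `X₀(49)`, from [Smi22a].** The
same with Smith's input the PUBLISHED J. Amer. Math. Soc. theorem (`h22`, [Smi22a] Thm. 1.2, via
file 6's Case II for `X₀(49)`). [cite: Smith2022SelmerTwistI, Thm. 1.2] [cite: BurungaleTian2026, Thm. 1.1]
[cite: BurungaleCastellaSkinnerTian2022, Thm. A] -/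
theorem bsdRank_twoThirds_allTwists_of_X049_of_smith2022 (h22 : smith2022_selmerCorank_distribution)
    (hBT : burungaleTian_analyticRank_eq_zero_of_selmerCorank_eq_zero_of_hasCM)
    (hA : thmA_analyticRank_eq_one_of_selmerCorank_eq_one)
    (hGZK : rank_eq_analyticRank_of_analyticRank_le_one) (hmod : exists_isNewformOf)
    {ε : ℝ} (hε : 0 < ε) :
    ∀ᶠ X : ℕ in atTop, 2 / 3 - ε ≤ (Nat.card {d : ℤ | Squarefree d ∧ |d| ≤ (X : ℤ) ∧
        ((cm7.quadraticTwist d).analyticRank = (cm7.quadraticTwist d).mordellWeilRank ∧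
          Finite (cm7.quadraticTwist d).sha)} : ℝ) /
      Nat.card {d : ℤ | Squarefree d ∧ |d| ≤ (X : ℤ)} :=
  bsdRank_twoThirds_allTwists_of_X049 (smith_selmerCorank_density_of_j_eq_neg3375 h22 cm7 j_cm7)
    hBT hA hGZK hmod hε

/-! ## §3 The last third, modulo the rank-one `2`-converse at additive `2` -/

/-- Burungale–Tian for the twists of `E₀`: `corank_{ℤ_2} Sel_{2^∞}(E₀^{(d)}) = 0 ⟹
ord_{s=1} L(E₀^{(d)}, s) = 0` for every `d ≠ 0` (`E₀^{(d)}` has CM). [cite: BurungaleTian2026, Thm. 1.1] -/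
theorem analyticRank_quadraticTwist_cm7_eq_zero
    (hBT : burungaleTian_analyticRank_eq_zero_of_selmerCorank_eq_zero_of_hasCM)
    (d : ℤ) (hd : d ≠ 0) (h : (cm7.quadraticTwist d).selmerCorank 2 = 0) :
    (cm7.quadraticTwist d).analyticRank = 0 := by
  have hd' : ((d : ℤ) : ℚ) ≠ 0 := by exact_mod_cast hd
  haveI := cm7.isElliptic_quadraticTwist hd'
  exact hBT _ (hasCM_quadraticTwist_of_hasCM cm7 (hasCM_of_j_eq_neg3375 cm7 j_cm7) hd') 2 h

/-- The residual `2`-converse `hK` (K12₂′: all elliptic `W/ℚ` with `j(W) ∈ {−3375, 16581375}`,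
ANY reduction at `2`) applied to the twists of `E₀` (`j(E₀^{(d)}) = j(E₀) = −3375`):
`corank_{ℤ_2} Sel_{2^∞}(E₀^{(d)}) = 1 ⟹ ord_{s=1} L(E₀^{(d)}, s) = 1`. `hK` is NOT in print
(BCST Rem. D; Keller–Yin Thm. 0.1.2 is the `p > 2` analogue). [cite: BurungaleCastellaSkinnerTian2022, Thm. A and Rem. D]
[cite: KellerYin2024PotOrd, Thm. 0.1.2] -/
theorem analyticRank_quadraticTwist_cm7_eq_one_of_twoConverse
    (hK : ∀ (W : WeierstrassCurve ℚ) [W.IsElliptic], (W.j = -3375 ∨ W.j = 16581375) →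
      W.selmerCorank 2 = 1 → W.analyticRank = 1)
    (d : ℤ) (hd : d ≠ 0) (h : (cm7.quadraticTwist d).selmerCorank 2 = 1) :
    (cm7.quadraticTwist d).analyticRank = 1 := by
  have hd' : ((d : ℤ) : ℚ) ≠ 0 := by exact_mod_cast hd
  haveI := cm7.isElliptic_quadraticTwist hd'
  exact hK _ (Or.inl (by rw [cm7.j_quadraticTwist hd']; exact j_cm7)) h

/-- **Goldfeld's conjecture for `X₀(49)` over ALL twists, modulo K12₂′.** Assuming Smith's
distribution theorem for `E₀` (`hS`), Burungale–Tian (`hBT`) and the residual rank-one `2`-converse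
`hK` (NOT in print): among all squarefree `d`, `ord_{s=1} L(E₀^{(d)}, s) = 0` for density `1/2`,
`= 1` for density `1/2`, `= r` for density `0` for every `r ≥ 2`
(`twistDensity_analyticRank_of_twoConverses`). [cite: arXiv250317619, Thm. 1.1 and Cor. 1.2]
[cite: BurungaleTian2026, Thm. 1.1] [cite: BurungaleCastellaSkinnerTian2022, Rem. D] -/
theorem goldfeld_allTwists_of_X049_of_twoConverse
    (hS : smith_selmerCorank_density cm7)
    (hBT : burungaleTian_analyticRank_eq_zero_of_selmerCorank_eq_zero_of_hasCM)
    (hK : ∀ (W : WeierstrassCurve ℚ) [W.IsElliptic], (W.j = -3375 ∨ W.j = 16581375) →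
      W.selmerCorank 2 = 1 → W.analyticRank = 1) :
    twistDensity (fun d ↦ d ≠ 0 ∧ (cm7.quadraticTwist d).analyticRank = 0) (1 / 2) ∧
      twistDensity (fun d ↦ d ≠ 0 ∧ (cm7.quadraticTwist d).analyticRank = 1) (1 / 2) ∧
        ∀ r : ℕ, 2 ≤ r →
          twistDensity (fun d ↦ d ≠ 0 ∧ (cm7.quadraticTwist d).analyticRank = r) 0 :=
  twistDensity_analyticRank_of_twoConverses cm7 (analyticRank_quadraticTwist_cm7_eq_zero hBT)
    (analyticRank_quadraticTwist_cm7_eq_one_of_twoConverse hK) hS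

/-- **Goldfeld for `X₀(49)` in the printed normalisation, modulo K12₂′**: for every `r`,
`#{d ∈ ℤ : 0 < |d| ≤ H, ord_{s=1} L(E₀^{(d)}, s) = r} / 2H → 1/2` if `r ≤ 1`, `→ 0` if `r ≥ 2`.
[cite: arXiv250317619, §1 (Goldfeld's Conjecture, display) and Cor. 1.2] [cite: BurungaleTian2026, Thm. 1.1] -/
theorem goldfeld_printed_allTwists_of_X049_of_twoConverse
    (hS : smith_selmerCorank_density cm7)
    (hBT : burungaleTian_analyticRank_eq_zero_of_selmerCorank_eq_zero_of_hasCM)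
    (hK : ∀ (W : WeierstrassCurve ℚ) [W.IsElliptic], (W.j = -3375 ∨ W.j = 16581375) →
      W.selmerCorank 2 = 1 → W.analyticRank = 1) (r : ℕ) :
    Tendsto (fun H : ℕ ↦ (Nat.card {d : ℤ | d ≠ 0 ∧ |d| ≤ (H : ℤ) ∧
        (cm7.quadraticTwist d).analyticRank = r} : ℝ) / (2 * H)) atTop
      (𝓝 (if r ≤ 1 then 1 / 2 else 0)) :=
  goldfeld_printed_of_twoConverses cm7 (analyticRank_quadraticTwist_cm7_eq_zero hBT)
    (analyticRank_quadraticTwist_cm7_eq_one_of_twoConverse hK) hS r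

/-- **Rank BSD for `100 %` of ALL quadratic twists of `X₀(49)`, modulo K12₂′.** Assuming `hS`,
`hBT`, Gross–Zagier–Kolyvagin (`hGZK`) and the residual `2`-converse `hK` (NOT in print; it
subsumes BCST Thm. A for these curves, so no `hA` here): the squarefree `d` with
`ord_{s=1} L(E₀^{(d)}, s) = rank E₀^{(d)}(ℚ)` and `Ш(E₀^{(d)}/ℚ)` finite have density `1`.
[cite: arXiv250317619, Thm. 1.1 and Cor. 1.2] [cite: BurungaleTian2026, Thm. 1.1]
[cite: BurungaleCastellaSkinnerTian2022, Rem. D] [cite: KellerYin2024PotOrd, Thm. 0.1.2 (the `p > 2` analogue)] -/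
theorem bsdRank_allTwists_of_X049_of_twoConverse
    (hS : smith_selmerCorank_density cm7)
    (hBT : burungaleTian_analyticRank_eq_zero_of_selmerCorank_eq_zero_of_hasCM)
    (hGZK : rank_eq_analyticRank_of_analyticRank_le_one)
    (hK : ∀ (W : WeierstrassCurve ℚ) [W.IsElliptic], (W.j = -3375 ∨ W.j = 16581375) →
      W.selmerCorank 2 = 1 → W.analyticRank = 1) :
    twistDensity (fun d ↦
      (cm7.quadraticTwist d).analyticRank = (cm7.quadraticTwist d).mordellWeilRank ∧
        Finite (cm7.quadraticTwist d).sha) 1 := by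
  have h := twistDensity_bsdRankFormula_finite_sha_of_twoConverses cm7
    (analyticRank_quadraticTwist_cm7_eq_zero hBT)
    (analyticRank_quadraticTwist_cm7_eq_one_of_twoConverse hK) hGZK hS
  refine (twistDensity_congr (fun d hd ↦ ?_) 1).1 h
  have hd0 : d ≠ 0 := hd.ne_zero
  simp only [WeierstrassCurve.BSDRankFormula]
  exact ⟨fun h' ↦ h' hd0, fun h' _ ↦ h'⟩

/-- **The residual is exactly the additive twists**: it suffices to assume the rank-one
`2`-converse ONLY for the twists `E₀^{(d)}` with `d` squarefree and `d ≢ 1 (mod 4)` (bad, additive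
reduction at `2`); on the good family `𝓕` BCST Thm. A (`hA`, good ordinary at `2`) does the work
(file 3). Conclusion as in `bsdRank_allTwists_of_X049_of_twoConverse`. [cite: arXiv250317619, Thm. 1.1]
[cite: BurungaleTian2026, Thm. 1.1] [cite: BurungaleCastellaSkinnerTian2022, Thm. A and Rem. D] -/
theorem bsdRank_allTwists_of_X049_of_offClass_twoConverse
    (hS : smith_selmerCorank_density cm7)
    (hBT : burungaleTian_analyticRank_eq_zero_of_selmerCorank_eq_zero_of_hasCM)
    (hA : thmA_analyticRank_eq_one_of_selmerCorank_eq_one)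
    (hGZK : rank_eq_analyticRank_of_analyticRank_le_one)
    (hK : ∀ d : ℤ, Squarefree d → d % 4 ≠ 1 →
      (cm7.quadraticTwist d).selmerCorank 2 = 1 → (cm7.quadraticTwist d).analyticRank = 1) :
    twistDensity (fun d ↦
      (cm7.quadraticTwist d).analyticRank = (cm7.quadraticTwist d).mordellWeilRank ∧
        Finite (cm7.quadraticTwist d).sha) 1 := by
  have hR := twistDensity_selmerCorankTwoInfty_le_one_of cm7 hS
  refine (twistDensity_congr_of_one (P := fun _ ↦ True) hR fun d hd hRd ↦ ?_).1 twistDensity_true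
  simp only [true_iff]
  by_cases hd4 : d % 4 = 1
  · obtain ⟨har, hrank, hsha⟩ :=
      analyticRank_eq_mordellWeilRank_quadraticTwist_of_selmerCorankTwoInfty_le_one hBT hA
        deuring_not_hasUnitRootAt_of_hasCM_of_not_cmSplit_holds hGZK cm7
        (hasCM_of_j_eq_neg3375 cm7 j_cm7) hasGoodReductionAtPrime_cm7_two
        (by rw [frobeniusTrace_cm7_two]; norm_num) hRd.1 hd4 hRd.2
    exact ⟨har.trans hrank.symm, hsha⟩
  · have hd' : ((d : ℤ) : ℚ) ≠ 0 := by exact_mod_cast hRd.1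
    haveI := cm7.isElliptic_quadraticTwist hd'
    have har : (cm7.quadraticTwist (d : ℚ)).analyticRank ≤ 1 := by
      rcases Nat.le_one_iff_eq_zero_or_eq_one.mp hRd.2 with h0 | h1
      · have h := analyticRank_quadraticTwist_cm7_eq_zero hBT d hRd.1
          ((selmerCorankTwoInfty_eq _).symm.trans h0)
        omega
      · have h := hK d hd hd4 ((selmerCorankTwoInfty_eq _).symm.trans h1)
        omega
    obtain ⟨hrank, hsha⟩ := hGZK (cm7.quadraticTwist (d : ℚ)) har
    exact ⟨hrank.symm, hsha⟩

/-- **Rank BSD for `100 %` of all quadratic twists of `X₀(49)`, modulo K12₂′, from [Smi22a].**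
[cite: Smith2022SelmerTwistI, Thm. 1.2] [cite: BurungaleTian2026, Thm. 1.1] [cite: BurungaleCastellaSkinnerTian2022, Rem. D] -/
theorem bsdRank_allTwists_of_X049_of_twoConverse_of_smith2022
    (h22 : smith2022_selmerCorank_distribution)
    (hBT : burungaleTian_analyticRank_eq_zero_of_selmerCorank_eq_zero_of_hasCM)
    (hGZK : rank_eq_analyticRank_of_analyticRank_le_one)
    (hK : ∀ (W : WeierstrassCurve ℚ) [W.IsElliptic], (W.j = -3375 ∨ W.j = 16581375) →
      W.selmerCorank 2 = 1 → W.analyticRank = 1) :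
    twistDensity (fun d ↦
      (cm7.quadraticTwist d).analyticRank = (cm7.quadraticTwist d).mordellWeilRank ∧
        Finite (cm7.quadraticTwist d).sha) 1 :=
  bsdRank_allTwists_of_X049_of_twoConverse (smith_selmerCorank_density_of_j_eq_neg3375 h22 cm7 j_cm7)
    hBT hGZK hK

end Summit.BirchSwinnertonDyer.BirchSwinnertonDyer.Theorems.GoldfeldGoodTwists

end
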